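import Literature.Analysis.Complex.VerticalSinSummation
import Mathlib.MeasureTheory.Integral.IntegralEqImproper
import Mathlib.Analysis.Complex.Liouville
import Mathlib.Analysis.Complex.RealDeriv
import HarnessLib

/-!
# Two integrations by parts along a vertical line: `∫ f'' cot(π·) = 2π² ∫ f cos(π·)/sin³(π·)`

Topic `Literature/Analysis/Complex` (contour integration), companion of `CotangentSummation.lean`.
Everything here is PROVED; no definitions, no named facts.

For `f` holomorphic on an open half-plane `{re z > a}` with `‖f z‖ ≤ C/(1 + ‖z‖²)` there, and a
non-integer `c > a`:

* `norm_iteratedDeriv_le_of_decay` — Cauchy's estimate transfers the decay to all derivatives: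
  `‖f⁽ⁿ⁾(z)‖ ≤ (n! 2(1+r²) C / rⁿ) / (1 + ‖z‖²)` whenever `a + r < re z` (`r > 0`);
* `hasDerivAt_cot_vertical`, `hasDerivAt_inv_sin_sq_vertical` — `(cot(π(c+iy)))' = −iπ/sin²`,
  `(sin⁻²(π(c+iy)))' = −2πi cos/sin³` (derivatives in the real variable `y`);
* `integral_iteratedDeriv_two_mul_cot_line` — two integrations by parts along `re z = c`:
  `∫ f''(c+iy) cot(π(c+iy)) dy = 2π² ∫ f(c+iy) cos(π(c+iy))/sin³(π(c+iy)) dy`,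
  the boundary terms vanishing because `f, f'` decay along the line while the kernels are bounded
  by powers of `1/|sin(πc)|`.

Combined with the cotangent summation formula (`Literature.Analysis.Complex.hasSum_int_mul_cot`)
this gives `Σ_{n > c} f''(n)/2 = −(π²/2) ∫ f(c+iy) cos/sin³(π(c+iy)) dy`, i.e. the representation
`½ Σ_t R''(t) = (1/2πi) ∫ R(t) π³ cos(πt)/sin³(πt) dt` of a hypergeometric sum (the kernel
`π³cos/sin³ = ½(π cot π·)''` has Laurent part `(t − n)⁻³` at each integer), the starting point of the
saddle-point analysis of Zudilin's linear forms in `1, ζ(5), …, ζ(11)` (J. Théor. Nombres Bordeaux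
16 (2004), (8.4)–(8.6) with `r = 3`; Izv. Math. 66 (2002), §4, Lemma 2 with `b = 3`). Folklore.
-/

noncomputable section

open _root_.Complex Set MeasureTheory Filter Real Metric
open scoped _root_.Topology

namespace Literature.Analysis.Complex

/-! ### Decay of derivatives from decay of the function (Cauchy's estimate) -/

/-- **Cauchy's estimate with the weight `1/(1+‖z‖²)`.** If `f` is holomorphic on `{re z > a}`
with `‖f z‖ ≤ C/(1+‖z‖²)` there, then for `0 < r` and `a + r < re z`,
`‖f⁽ⁿ⁾(z)‖ ≤ (n! · 2(1+r²) C / rⁿ) / (1 + ‖z‖²)`. [folklore] -/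
theorem norm_iteratedDeriv_le_of_decay {f : ℂ → ℂ} {a C r : ℝ} (hr : 0 < r)
    (hf : DifferentiableOn ℂ f {z : ℂ | a < z.re})
    (hb : ∀ z : ℂ, a < z.re → ‖f z‖ ≤ C / (1 + ‖z‖ ^ 2)) (n : ℕ) {z : ℂ} (hz : a + r < z.re) :
    ‖iteratedDeriv n f z‖ ≤ (n.factorial * (2 * (1 + r ^ 2) * C) / r ^ n) / (1 + ‖z‖ ^ 2) := by
  have hzre : a < z.re := by linarith
  have hC : 0 ≤ C := by
    have h := hb z hzre
    have h0 : (0 : ℝ) < 1 + ‖z‖ ^ 2 := by positivity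
    by_contra hneg
    have : C / (1 + ‖z‖ ^ 2) < 0 := div_neg_of_neg_of_pos (not_le.1 hneg) h0
    linarith [norm_nonneg (f z)]
  -- the closed disc `|w - z| ≤ r` lies in the half-plane
  have hsub : closedBall z r ⊆ {w : ℂ | a < w.re} := by
    intro w hw
    rw [mem_closedBall, dist_eq_norm] at hw
    have : |(w - z).re| ≤ r := (abs_re_le_norm _).trans hw
    rw [sub_re, abs_le] at this
    simp only [mem_setOf_eq]
    linarith [this.1]
  have hdc : DiffContOnCl ℂ f (ball z r) := by
    refine DifferentiableOn.diffContOnCl ?_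
    rw [closure_ball z hr.ne']
    exact hf.mono hsub
  -- the bound on the circle
  have hsph : ∀ w ∈ sphere z r, ‖f w‖ ≤ 2 * (1 + r ^ 2) * C / (1 + ‖z‖ ^ 2) := by
    intro w hw
    have hw' : w ∈ closedBall z r := sphere_subset_closedBall hw
    have hwre : a < w.re := hsub hw'
    refine (hb w hwre).trans ?_
    rw [mem_sphere, dist_eq_norm] at hw
    have hzw : ‖z‖ ≤ ‖w‖ + r := by
      have := norm_sub_norm_le z w
      rw [← norm_neg (z - w), neg_sub, hw] at this
      linarith
    have key : 1 + ‖z‖ ^ 2 ≤ 2 * (1 + r ^ 2) * (1 + ‖w‖ ^ 2) := by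
      nlinarith [sq_nonneg (‖w‖ - r), norm_nonneg w, hr.le, norm_nonneg z]
    rw [div_le_div_iff₀ (by positivity) (by positivity)]
    nlinarith [key, hC]
  have h := Complex.norm_iteratedDeriv_le_of_forall_mem_sphere_norm_le n hr hdc hsph
  refine h.trans (le_of_eq ?_)
  field_simp

/-! ### Derivatives along a vertical line -/

/-- Chain rule along the line `y ↦ c + iy`. [folklore] -/
theorem hasDerivAt_comp_vertical {g : ℂ → ℂ} {g' : ℂ} {c y : ℝ}
    (hg : HasDerivAt g g' (c + y * I)) :
    HasDerivAt (fun t : ℝ ↦ g (c + t * I)) (g' * I) y := by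
  have hline : HasDerivAt (fun t : ℂ ↦ (c : ℂ) + t * I) I (y : ℂ) := by
    simpa using ((hasDerivAt_id (y : ℂ)).mul_const I).const_add (c : ℂ)
  have := (hg.comp (y : ℂ) hline).comp_ofReal
  simpa using this

/-- On the open half-plane `{re z > a}` all `iteratedDeriv n f` are differentiable, with
derivative `iteratedDeriv (n+1) f`. [folklore] -/
theorem hasDerivAt_iteratedDeriv_halfPlane {f : ℂ → ℂ} {a : ℝ}
    (hf : DifferentiableOn ℂ f {z : ℂ | a < z.re}) (n : ℕ) {z : ℂ} (hz : a < z.re) :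
    HasDerivAt (iteratedDeriv n f) (iteratedDeriv (n + 1) f z) z := by
  have hopen : IsOpen {z : ℂ | a < z.re} := isOpen_lt continuous_const Complex.continuous_re
  have hd : DifferentiableOn ℂ (iteratedDeriv n f) {z : ℂ | a < z.re} := by
    induction n with
    | zero => simpa using hf
    | succ k ih => rw [iteratedDeriv_succ]; exact ih.deriv hopen
  rw [iteratedDeriv_succ]
  exact (hd.differentiableAt (hopen.mem_nhds hz)).hasDerivAt

/-- Continuity of `y ↦ f⁽ⁿ⁾(c + iy)` for `c > a`. [folklore] -/
theorem continuous_iteratedDeriv_vertical {f : ℂ → ℂ} {a c : ℝ} (hac : a < c)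
    (hf : DifferentiableOn ℂ f {z : ℂ | a < z.re}) (n : ℕ) :
    Continuous fun y : ℝ ↦ iteratedDeriv n f (c + y * I) :=
  continuous_iff_continuousAt.2 fun y ↦
    (hasDerivAt_comp_vertical (hasDerivAt_iteratedDeriv_halfPlane hf n (by simp [hac]))).continuousAt

/-! ### The kernels `cot`, `sin⁻²`, `cos/sin³` along a vertical line -/

/-- `d/dy cot(π(c+iy)) = −iπ / sin²(π(c+iy))` (where `sin ≠ 0`). [folklore] -/
theorem hasDerivAt_cot_vertical {c y : ℝ} (hs : Complex.sin (π * (c + y * I)) ≠ 0) :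
    HasDerivAt (fun t : ℝ ↦ Complex.cos (π * (c + t * I)) / Complex.sin (π * (c + t * I)))
      (-(π * I) / Complex.sin (π * (c + y * I)) ^ 2) y := by
  have hlin : HasDerivAt (fun w : ℂ ↦ (π : ℂ) * w) ((π : ℂ) * 1) (c + y * I) :=
    (hasDerivAt_id ((c : ℂ) + y * I)).const_mul (π : ℂ)
  have hcos := hlin.ccos
  have hsin := hlin.csin
  have hq := hcos.div hsin hs
  have h := hasDerivAt_comp_vertical hq
  refine h.congr_deriv ?_
  have hss := Complex.sin_sq_add_cos_sq (π * (c + y * I))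
  rw [div_mul_eq_mul_div, div_left_inj' (pow_ne_zero 2 hs)]
  linear_combination (-(π : ℂ) * I) * hss

/-- `d/dy sin⁻²(π(c+iy)) = −2πi cos(π(c+iy)) / sin³(π(c+iy))`. [folklore] -/
theorem hasDerivAt_inv_sin_sq_vertical {c y : ℝ} (hs : Complex.sin (π * (c + y * I)) ≠ 0) :
    HasDerivAt (fun t : ℝ ↦ (Complex.sin (π * (c + t * I)) ^ 2)⁻¹)
      (-(2 * π * I) * Complex.cos (π * (c + y * I)) / Complex.sin (π * (c + y * I)) ^ 3) y := by
  have hlin : HasDerivAt (fun w : ℂ ↦ (π : ℂ) * w) ((π : ℂ) * 1) (c + y * I) :=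
    (hasDerivAt_id ((c : ℂ) + y * I)).const_mul (π : ℂ)
  have hsin := hlin.csin
  have h2 := (hsin.fun_pow 2).fun_inv (pow_ne_zero 2 hs)
  have h := hasDerivAt_comp_vertical h2
  refine h.congr_deriv ?_
  field_simp
  ring

/-- `sin(π(c+iy)) ≠ 0` when `c ∉ ℤ`. [folklore] -/
theorem sin_vertical_ne_zero {c : ℝ} (hcZ : ∀ n : ℤ, (n : ℝ) ≠ c) (y : ℝ) :
    Complex.sin (π * (c + y * I)) ≠ 0 := by
  have hsc : Real.sin (π * c) ≠ 0 := by
    rw [Real.sin_ne_zero_iff]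
    intro n hn
    apply hcZ n
    have : (n : ℝ) * π = c * π := by rw [mul_comm c]; exact hn
    exact mul_right_cancel₀ Real.pi_ne_zero this
  intro h0
  have := abs_sin_re_le_norm_sin (π * (c + y * I))
  rw [h0, norm_zero] at this
  have hre : (π * ((c : ℂ) + y * I)).re = π * c := by simp
  rw [hre] at this
  exact hsc (abs_eq_zero.1 (le_antisymm this (abs_nonneg _)))

/-- `|sin(πc)| ≤ ‖sin(π(c+iy))‖`. [folklore] -/
theorem abs_sin_le_norm_sin_vertical (c y : ℝ) :
    |Real.sin (π * c)| ≤ ‖Complex.sin (π * (c + y * I))‖ := by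
  have := abs_sin_re_le_norm_sin (π * (c + y * I))
  have hre : (π * ((c : ℂ) + y * I)).re = π * c := by simp
  rwa [hre] at this

/-- `1/(1 + y²) → 0` as `y → ±∞` (both filters at once, via `cocompact`-free statements).
[folklore] -/
theorem tendsto_inv_one_add_sq_atTop :
    Tendsto (fun y : ℝ ↦ 1 / (1 + y ^ 2)) atTop (𝓝 0) := by
  refine tendsto_const_nhds.div_atTop ?_
  exact tendsto_atTop_add_const_left _ _ (tendsto_pow_atTop two_ne_zero)

/-- `1/(1 + y²) → 0` as `y → −∞`. [folklore] -/
theorem tendsto_inv_one_add_sq_atBot :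
    Tendsto (fun y : ℝ ↦ 1 / (1 + y ^ 2)) atBot (𝓝 0) := by
  have := tendsto_inv_one_add_sq_atTop.comp tendsto_neg_atBot_atTop
  refine this.congr fun y ↦ ?_
  simp

/-- A product `k · φ` with `‖k‖ ≤ B` and `‖φ y‖ ≤ K/(1+y²)` tends to `0` at `±∞` and is
integrable when both factors are continuous. [folklore] -/
theorem aux_decay_product {k φ : ℝ → ℂ} {B K : ℝ} (hk : Continuous k) (hφ : Continuous φ)
    (hkB : ∀ y, ‖k y‖ ≤ B) (hφK : ∀ y, ‖φ y‖ ≤ K / (1 + y ^ 2)) :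
    Integrable (fun y ↦ k y * φ y) ∧ Tendsto (fun y ↦ k y * φ y) atBot (𝓝 0) ∧
      Tendsto (fun y ↦ k y * φ y) atTop (𝓝 0) := by
  have hB : 0 ≤ B := (norm_nonneg _).trans (hkB 0)
  have hK : 0 ≤ K := by
    have := hφK 0
    simp only [ne_eq, OfNat.ofNat_ne_zero, not_false_eq_true, zero_pow, add_zero, div_one] at this
    exact (norm_nonneg _).trans this
  have hbd : ∀ y, ‖k y * φ y‖ ≤ B * K * (1 / (1 + y ^ 2)) := by
    intro y
    rw [norm_mul]
    calc ‖k y‖ * ‖φ y‖ ≤ B * (K / (1 + y ^ 2)) :=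
          mul_le_mul (hkB y) (hφK y) (norm_nonneg _) hB
      _ = B * K * (1 / (1 + y ^ 2)) := by ring
  refine ⟨?_, ?_, ?_⟩
  · refine Integrable.mono' ((integrable_inv_one_add_sq.const_mul (B * K))) (hk.mul hφ).aestronglyMeasurable
      (Eventually.of_forall fun y ↦ ?_)
    simpa [div_eq_mul_inv] using hbd y
  · refine squeeze_zero_norm (fun y ↦ hbd y) ?_
    simpa using tendsto_inv_one_add_sq_atBot.const_mul (B * K)
  · refine squeeze_zero_norm (fun y ↦ hbd y) ?_
    simpa using tendsto_inv_one_add_sq_atTop.const_mul (B * K)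

/-! ### Two integrations by parts -/

/-- **`∫ f'' cot = 2π² ∫ f cos/sin³` along a vertical line.** Let `f` be holomorphic on
`{re z > a}` with `‖f z‖ ≤ C/(1+‖z‖²)` there, and `c > a` a non-integer. Then
`∫ f''(c+iy) cot(π(c+iy)) dy = 2π² ∫ f(c+iy) cos(π(c+iy))/sin³(π(c+iy)) dy`
(both absolutely convergent): integrate by parts twice in `y`, using
`(cot(π(c+iy)))' = −iπ/sin²`, `(sin⁻²(π(c+iy)))' = −2πi cos/sin³`, the boundary terms vanishing
because `f, f'` decay along the line (Cauchy's estimate) while the kernels are bounded by powers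
of `1/|sin(πc)|`. [folklore] -/
theorem integral_iteratedDeriv_two_mul_cot_line {f : ℂ → ℂ} {a c C : ℝ} (hac : a < c)
    (hcZ : ∀ n : ℤ, (n : ℝ) ≠ c)
    (hf : DifferentiableOn ℂ f {z : ℂ | a < z.re})
    (hb : ∀ z : ℂ, a < z.re → ‖f z‖ ≤ C / (1 + ‖z‖ ^ 2)) :
    ∫ y : ℝ, iteratedDeriv 2 f (c + y * I) *
        (Complex.cos (π * (c + y * I)) / Complex.sin (π * (c + y * I))) =
      2 * π ^ 2 * ∫ y : ℝ, f (c + y * I) *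
        (Complex.cos (π * (c + y * I)) / Complex.sin (π * (c + y * I)) ^ 3) := by
  -- notation
  set φ : ℕ → ℝ → ℂ := fun j y ↦ iteratedDeriv j f (c + y * I) with hφ
  set sn : ℝ → ℂ := fun y ↦ Complex.sin (π * (c + y * I)) with hsn
  set cs : ℝ → ℂ := fun y ↦ Complex.cos (π * (c + y * I)) with hcs
  set κ : ℝ → ℂ := fun y ↦ cs y / sn y with hκ
  set lam : ℝ → ℂ := fun y ↦ (sn y ^ 2)⁻¹ with hlam
  set μ : ℝ → ℂ := fun y ↦ cs y / sn y ^ 3 with hμ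
  have hs0 : ∀ y, sn y ≠ 0 := fun y ↦ sin_vertical_ne_zero hcZ y
  have hsc : 0 < |Real.sin (π * c)| := by
    rcases eq_or_ne (Real.sin (π * c)) 0 with h0 | h0
    · exfalso
      have := hs0 0
      simp only [hsn, ofReal_zero, zero_mul, add_zero] at this
      exact this (by rw [← Complex.ofReal_mul, ← Complex.ofReal_sin, h0, ofReal_zero])
    · exact abs_pos.2 h0
  set σ : ℝ := |Real.sin (π * c)| with hσ
  have hσle : ∀ y, σ ≤ ‖sn y‖ := fun y ↦ abs_sin_le_norm_sin_vertical c y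
  -- kernel bounds
  have hκB : ∀ y, ‖κ y‖ ≤ σ⁻¹ := fun y ↦ by
    have := norm_cos_div_sin_le_inv_abs_sin (π * (c + y * I)) (by
      have hre : (π * ((c : ℂ) + y * I)).re = π * c := by simp
      rw [hre]; exact (abs_pos.1 hsc))
    have hre : (π * ((c : ℂ) + y * I)).re = π * c := by simp
    rw [hre] at this
    exact this
  have hlamB : ∀ y, ‖lam y‖ ≤ (σ ^ 2)⁻¹ := fun y ↦ by
    simp only [hlam, norm_inv, norm_pow]
    exact inv_anti₀ (by positivity) (pow_le_pow_left₀ hsc.le (hσle y) 2)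
  have hμB : ∀ y, ‖μ y‖ ≤ σ⁻¹ * (σ ^ 2)⁻¹ := fun y ↦ by
    have : μ y = κ y * lam y := by
      simp only [hμ, hκ, hlam]; field_simp
    rw [this, norm_mul]
    exact mul_le_mul (hκB y) (hlamB y) (norm_nonneg _) (by positivity)
  -- continuity of the kernels
  have hsn_cont : Continuous sn := by simp only [hsn]; fun_prop
  have hcs_cont : Continuous cs := by simp only [hcs]; fun_prop
  have hκ_cont : Continuous κ := hcs_cont.div hsn_cont hs0
  have hlam_cont : Continuous lam := (hsn_cont.pow 2).inv₀ fun y ↦ pow_ne_zero 2 (hs0 y)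
  have hμ_cont : Continuous μ := hcs_cont.div (hsn_cont.pow 3) fun y ↦ pow_ne_zero 3 (hs0 y)
  -- derivatives of the kernels
  have hκ_der : ∀ y, HasDerivAt κ (-(π * I) * lam y) y := fun y ↦ by
    have := hasDerivAt_cot_vertical (c := c) (y := y) (hs0 y)
    simp only [hκ, hlam, hcs, hsn]
    convert this using 1
    field_simp
  have hlam_der : ∀ y, HasDerivAt lam (-(2 * π * I) * μ y) y := fun y ↦ by
    have := hasDerivAt_inv_sin_sq_vertical (c := c) (y := y) (hs0 y)
    simp only [hlam, hμ, hcs, hsn]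
    convert this using 1
    field_simp
  -- the functions `φ j` : derivatives, continuity, decay
  have hφ_der : ∀ j y, HasDerivAt (φ j) (φ (j + 1) y * I) y := fun j y ↦
    hasDerivAt_comp_vertical (hasDerivAt_iteratedDeriv_halfPlane hf j (by simp [hac]))
  have hφ_cont : ∀ j, Continuous (φ j) := fun j ↦ continuous_iteratedDeriv_vertical hac hf j
  set r : ℝ := (c - a) / 2 with hr
  have hr0 : 0 < r := by rw [hr]; linarith
  have hφK : ∀ j y, ‖φ j y‖ ≤ (j.factorial * (2 * (1 + r ^ 2) * C) / r ^ j) / (1 + y ^ 2) := by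
    intro j y
    have hz : a + r < ((c : ℂ) + y * I).re := by simp; rw [hr]; linarith
    have h := norm_iteratedDeriv_le_of_decay hr0 hf hb j hz
    refine h.trans ?_
    have hnum : 0 ≤ (j.factorial * (2 * (1 + r ^ 2) * C) / r ^ j) := by
      have hC : 0 ≤ C := by
        have h' := hb ((c : ℂ) + y * I) (by simp [hac])
        by_contra hneg
        have : C / (1 + ‖(c : ℂ) + y * I‖ ^ 2) < 0 :=
          div_neg_of_neg_of_pos (not_le.1 hneg) (by positivity)
        linarith [norm_nonneg (f ((c : ℂ) + y * I))]
      positivity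
    refine div_le_div_of_nonneg_left hnum (by positivity) ?_
    have : |y| ≤ ‖(c : ℂ) + y * I‖ := by simpa using Complex.abs_im_le_norm ((c : ℂ) + y * I)
    nlinarith [sq_abs y, abs_nonneg y]
  -- first integration by parts: `∫ κ (φ₂ I) = ∫ (π I lam) φ₁`
  obtain ⟨hI1, hbot1, htop1⟩ := aux_decay_product hκ_cont (hφ_cont 1) hκB (hφK 1)
  obtain ⟨hI2, -, -⟩ := aux_decay_product hlam_cont (hφ_cont 1) hlamB (hφK 1)
  obtain ⟨hI3, -, -⟩ := aux_decay_product hκ_cont (hφ_cont 2) hκB (hφK 2)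
  obtain ⟨hI4, hbot4, htop4⟩ := aux_decay_product hlam_cont (hφ_cont 0) hlamB (hφK 0)
  obtain ⟨hI5, -, -⟩ := aux_decay_product hμ_cont (hφ_cont 0) hμB (hφK 0)
  have ibp1 : ∫ y, κ y * (φ 2 y * I) = ∫ y, (π * I * lam y) * φ 1 y := by
    have h := integral_mul_deriv_eq_deriv_mul (u := κ) (v := φ 1)
      (u' := fun y ↦ -(π * I) * lam y) (v' := fun y ↦ φ 2 y * I)
      (fun y _ ↦ hκ_der y) (fun y _ ↦ hφ_der 1 y) ?_ ?_ hbot1 htop1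
    · rw [h, sub_self, zero_sub, ← MeasureTheory.integral_neg]
      refine integral_congr_ae (Eventually.of_forall fun y ↦ ?_)
      simp only; ring
    · have : (κ * fun y ↦ φ 2 y * I) = fun y ↦ I * (κ y * φ 2 y) := by
        ext y; simp only [Pi.mul_apply]; ring
      rw [this]; exact hI3.const_mul I
    · have : ((fun y ↦ -(π * I) * lam y) * φ 1) = fun y ↦ (-(π * I)) * (lam y * φ 1 y) := by
        ext y; simp only [Pi.mul_apply]; ring
      rw [this]; exact hI2.const_mul _
  -- second integration by parts: `∫ lam (φ₁ I) = ∫ (2π I μ) φ₀`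
  have ibp2 : ∫ y, lam y * (φ 1 y * I) = ∫ y, (2 * π * I * μ y) * φ 0 y := by
    have h := integral_mul_deriv_eq_deriv_mul (u := lam) (v := φ 0)
      (u' := fun y ↦ -(2 * π * I) * μ y) (v' := fun y ↦ φ 1 y * I)
      (fun y _ ↦ hlam_der y) (fun y _ ↦ hφ_der 0 y) ?_ ?_ hbot4 htop4
    · rw [h, sub_self, zero_sub, ← MeasureTheory.integral_neg]
      refine integral_congr_ae (Eventually.of_forall fun y ↦ ?_)
      simp only; ring
    · have : (lam * fun y ↦ φ 1 y * I) = fun y ↦ I * (lam y * φ 1 y) := by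
        ext y; simp only [Pi.mul_apply]; ring
      rw [this]; exact hI2.const_mul I
    · have : ((fun y ↦ -(2 * π * I) * μ y) * φ 0) = fun y ↦ (-(2 * π * I)) * (μ y * φ 0 y) := by
        ext y; simp only [Pi.mul_apply]; ring
      rw [this]; exact hI5.const_mul _
  -- assemble
  have step1 : ∫ y, φ 2 y * κ y = -I * ∫ y, κ y * (φ 2 y * I) := by
    rw [← MeasureTheory.integral_const_mul]
    refine integral_congr_ae (Eventually.of_forall fun y ↦ ?_)
    simp only
    rw [show -I * (κ y * (φ 2 y * I)) = -(I * I) * (φ 2 y * κ y) by ring, I_mul_I]; ring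
  have step2 : ∫ y, (π * I * lam y) * φ 1 y = π * ∫ y, lam y * (φ 1 y * I) := by
    rw [← MeasureTheory.integral_const_mul]
    refine integral_congr_ae (Eventually.of_forall fun y ↦ ?_)
    simp only; ring
  have step3 : ∫ y, (2 * π * I * μ y) * φ 0 y = 2 * π * I * ∫ y, φ 0 y * μ y := by
    rw [← MeasureTheory.integral_const_mul]
    refine integral_congr_ae (Eventually.of_forall fun y ↦ ?_)
    simp only; ring
  have hgoal : ∫ y, φ 2 y * κ y = 2 * π ^ 2 * ∫ y, φ 0 y * μ y := by
    rw [step1, ibp1, step2, ibp2, step3]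
    rw [show -I * (π * (2 * π * I * ∫ y, φ 0 y * μ y)) = -(I * I) * (2 * π ^ 2) * ∫ y, φ 0 y * μ y
      by ring, I_mul_I]
    ring
  simpa [hφ, hκ, hμ, hcs, hsn] using hgoal

end Literature.Analysis.Complex
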